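import Summits.FinalStateConjecture.FinalStateConjecture.Theses.EIHFluxBalance

/-!
# Route EIHFluxBalance — `InertialRecession`, re-charting: Barbălat's lemma (the lag of hole time
# behind lab time either grows without bound or the hole comes to rest)

Helper file for the crux `stmt-FinalStateConjecture-10166`
(`Summit.FinalStateConjecture.FinalStateConjecture.Theses.EIHFluxBalance.InertialRecession`),
line `sublinear-is-free-clean-window-charges`, stub `stub_rechart` (the transfer P2, reshape r4).

On the certified tube `{rᵢ ≤ Rᵢ(t*)}` of a hole chart the lab time of the chart point `(t*, z̲′)`
is `T₀(t*) + ℓ(T₀ t*)·z̲′` with `T₀(t*) = t* + C + D(t*)`, `D(t*) = ∫₀^{t*} (u⁰(T₀ σ) − 1) dσ ≥ 0`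
(the accumulated time dilation) and tilt `|ℓ| = √((u⁰)² − 1)`. The causal transfer places the
side walls where lab time ≥ hole time, i.e. it needs `|ℓ(T₀ t*)| (Rᵢ(t*) + |aᵢ|) ≤ C + D(t*)` with
`Rᵢ → ∞`; this is possible because the ratio `√(φ(φ+2)) / (C + ∫₀ᵗ φ)`, `φ = u⁰ ∘ T₀ − 1 ≥ 0`,
tends to `0`: either `∫ φ → ∞` (numerator bounded), or `∫ φ` is bounded and then `φ → 0` by
**Barbălat's lemma** — a nonnegative, uniformly continuous function with bounded integral tends to
`0` (`tendsto_zero_of_uniformContinuous_of_integral_le`; slaving makes `φ′ → 0`, so `φ` is even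
Lipschitz). This file proves the lemma and the dichotomy-free consequence
`tendsto_sqrt_div_integral'` (registered one-line form unprimed) : `√(φ(φ+2)) / (C + ∫₀ᵗ φ) → 0`.

[Barbălat 1959; folklore real analysis, Mathlib interval integrals]
-/

noncomputable section

set_option linter.dupNamespace false

open Set Filter Function Topology MeasureTheory
open scoped Topology

namespace Summit.FinalStateConjecture.FinalStateConjecture.Theorems.SublinearIsFree.Rechart

/-- **Barbălat's lemma.** A nonnegative, uniformly continuous `φ : ℝ → ℝ` whose integrals
`∫₀ᵗ φ` (`t ≥ 0`) are bounded tends to `0` at `+∞`: otherwise `φ ≥ ε` frequently, hence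
`φ ≥ ε/2` on intervals of fixed length `δ` arbitrarily late, while the nondecreasing bounded
primitive is Cauchy. [folklore] -/
theorem tendsto_zero_of_uniformContinuous_of_integral_le {φ : ℝ → ℝ} (hc : Continuous φ)
    (h0 : ∀ t, 0 ≤ φ t) (huc : UniformContinuous φ) {B : ℝ}
    (hB : ∀ t, 0 ≤ t → ∫ s in (0 : ℝ)..t, φ s ≤ B) : Tendsto φ atTop (𝓝 0) := by
  -- the primitive is monotone and bounded on `[0, ∞)`, hence convergent, hence Cauchy
  set F : ℝ → ℝ := fun t ↦ ∫ s in (0 : ℝ)..max t 0, φ s with hF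
  have hint : ∀ a b, IntervalIntegrable φ volume a b := fun a b ↦ hc.intervalIntegrable a b
  have hFmono : Monotone F := by
    intro t t' htt'
    simp only [hF]
    have hle : max t 0 ≤ max t' 0 := max_le_max htt' le_rfl
    rw [← intervalIntegral.integral_add_adjacent_intervals (hint 0 (max t 0)) (hint (max t 0) (max t' 0))]
    have : 0 ≤ ∫ s in (max t 0)..(max t' 0), φ s :=
      intervalIntegral.integral_nonneg hle fun s _ ↦ h0 s
    linarith
  have hFbdd : BddAbove (range F) := ⟨B, by
    rintro _ ⟨t, rfl⟩
    exact hB _ (le_max_right t 0)⟩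
  have hFlim : Tendsto F atTop (𝓝 (⨆ t, F t)) := tendsto_atTop_ciSup hFmono hFbdd
  -- suppose `φ` does not tend to `0`
  rw [Metric.tendsto_nhds]
  by_contra hnot
  push Not at hnot
  obtain ⟨ε, hε, hfreq⟩ := hnot
  -- uniform continuity: `|s - t| < δ ⇒ |φ s - φ t| < ε / 2`
  obtain ⟨δ, hδ, hδuc⟩ := Metric.uniformContinuous_iff.mp huc (ε / 2) (half_pos hε)
  -- the Cauchy property of `F` on the scale `δ / 2`
  have hC : Tendsto (fun t ↦ F (t + δ / 2) - F t) atTop (𝓝 0) := by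
    have h1 : Tendsto (fun t ↦ F (t + δ / 2)) atTop (𝓝 (⨆ t, F t)) :=
      hFlim.comp (tendsto_atTop_add_const_right atTop (δ / 2) tendsto_id)
    simpa using h1.sub hFlim
  have hev : ∀ᶠ t in atTop, F (t + δ / 2) - F t < ε / 2 * (δ / 2) :=
    ((Metric.tendsto_nhds.mp hC) (ε / 2 * (δ / 2)) (by positivity)).mono fun t ht ↦ by
      rw [Real.dist_eq, sub_zero] at ht
      exact lt_of_abs_lt ht
  -- a late time where `φ ≥ ε` and the Cauchy bound holds
  obtain ⟨t, ⟨ht0, hsmall⟩, hbig⟩ := ((eventually_ge_atTop (0 : ℝ)).and hev).and_frequently hfreq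
    |>.exists
  rw [Real.dist_eq, sub_zero, abs_of_nonneg (h0 t)] at hbig
  -- on `[t, t + δ/2]` the function is at least `ε / 2`
  have hlow : ∀ s ∈ Icc t (t + δ / 2), ε / 2 ≤ φ s := by
    intro s hs
    have hst : dist s t < δ := by
      rw [Real.dist_eq, abs_of_nonneg (by linarith [hs.1])]
      linarith [hs.2]
    have h := hδuc hst
    rw [Real.dist_eq] at h
    have := neg_lt_of_abs_lt h
    linarith
  have hI : ε / 2 * (δ / 2) ≤ ∫ s in t..(t + δ / 2), φ s := by
    have h := intervalIntegral.integral_mono_on (by linarith) (by simp) (hint t (t + δ / 2)) hlow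
    have h2 : ∫ _ in t..(t + δ / 2), (ε / 2 : ℝ) = ε / 2 * (δ / 2) := by
      rw [intervalIntegral.integral_const, smul_eq_mul]
      ring
    rwa [h2] at h
  -- but this is `F (t + δ/2) - F t`
  have hFt : F (t + δ / 2) - F t = ∫ s in t..(t + δ / 2), φ s := by
    simp only [hF]
    rw [max_eq_left ht0, max_eq_left (by linarith),
      ← intervalIntegral.integral_add_adjacent_intervals (hint 0 t) (hint t (t + δ / 2))]
    ring
  linarith

/-- **The tilt-to-lag ratio tends to zero.** For `φ ≥ 0` bounded and uniformly continuous and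
`C > 0`, `√(φ t (φ t + 2)) / (C + ∫₀ᵗ φ) → 0` as `t → ∞`: if the primitive is unbounded the
numerator is bounded, otherwise `φ → 0` by Barbălat's lemma. (With `φ = u⁰ ∘ T₀ − 1` the numerator
is the tilt `|ℓ(T₀ t)| = √((u⁰)² − 1)` of the hole slab and the denominator the lag of lab time
over hole time at the centre.) [folklore] -/
theorem tendsto_sqrt_div_integral' {φ : ℝ → ℝ} (hc : Continuous φ) (h0 : ∀ t, 0 ≤ φ t) {Bφ : ℝ}
    (hφB : ∀ t, φ t ≤ Bφ) (huc : UniformContinuous φ) {C : ℝ} (hC : 0 < C) :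
    Tendsto (fun t ↦ √(φ t * (φ t + 2)) / (C + ∫ s in (0 : ℝ)..t, φ s)) atTop (𝓝 0) := by
  have hint : ∀ a b, IntervalIntegrable φ volume a b := fun a b ↦ hc.intervalIntegrable a b
  have hInn : ∀ t, 0 ≤ t → 0 ≤ ∫ s in (0 : ℝ)..t, φ s := fun t ht ↦
    intervalIntegral.integral_nonneg ht fun s _ ↦ h0 s
  have hnum : ∀ t, √(φ t * (φ t + 2)) ≤ √(Bφ * (Bφ + 2)) := fun t ↦ by
    have h1 := h0 t
    have h2 := hφB t
    exact Real.sqrt_le_sqrt (by nlinarith)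
  by_cases hbdd : ∃ B, ∀ t, 0 ≤ t → ∫ s in (0 : ℝ)..t, φ s ≤ B
  · -- bounded primitive: Barbălat
    obtain ⟨B, hB⟩ := hbdd
    have hφ0 := tendsto_zero_of_uniformContinuous_of_integral_le hc h0 huc hB
    have hnum0 : Tendsto (fun t ↦ √(φ t * (φ t + 2))) atTop (𝓝 0) := by
      have h1 : Tendsto (fun t ↦ φ t * (φ t + 2)) atTop (𝓝 0) := by
        simpa using hφ0.mul (hφ0.add_const 2)
      simpa using h1.sqrt
    rw [Metric.tendsto_nhds] at hnum0 ⊢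
    intro ε hε
    filter_upwards [hnum0 (ε * C) (by positivity), eventually_ge_atTop (0 : ℝ)] with t ht ht0
    rw [Real.dist_eq, sub_zero] at ht ⊢
    have hden : C ≤ C + ∫ s in (0 : ℝ)..t, φ s := by linarith [hInn t ht0]
    have hdenpos : 0 < C + ∫ s in (0 : ℝ)..t, φ s := hC.trans_le hden
    rw [abs_of_nonneg (div_nonneg (Real.sqrt_nonneg _) hdenpos.le), div_lt_iff₀ hdenpos]
    rw [abs_of_nonneg (Real.sqrt_nonneg _)] at ht
    calc √(φ t * (φ t + 2)) < ε * C := ht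
      _ ≤ ε * (C + ∫ s in (0 : ℝ)..t, φ s) := by gcongr
  · -- unbounded primitive: it tends to `+∞` (monotone), the numerator is bounded
    push Not at hbdd
    have hmono : Monotone fun t : ℝ ↦ ∫ s in (0 : ℝ)..max t 0, φ s := by
      intro t t' htt'
      have hle : max t 0 ≤ max t' 0 := max_le_max htt' le_rfl
      show ∫ s in (0 : ℝ)..max t 0, φ s ≤ ∫ s in (0 : ℝ)..max t' 0, φ s
      rw [← intervalIntegral.integral_add_adjacent_intervals (hint 0 (max t 0))
        (hint (max t 0) (max t' 0))]
      have : 0 ≤ ∫ s in (max t 0)..(max t' 0), φ s :=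
        intervalIntegral.integral_nonneg hle fun s _ ↦ h0 s
      linarith
    have htop : Tendsto (fun t : ℝ ↦ ∫ s in (0 : ℝ)..max t 0, φ s) atTop atTop := by
      refine hmono.tendsto_atTop_atTop fun b ↦ ?_
      obtain ⟨t, ht0, hbt⟩ := hbdd b
      exact ⟨t, by rw [max_eq_left ht0]; exact hbt.le⟩
    have htop' : Tendsto (fun t : ℝ ↦ C + ∫ s in (0 : ℝ)..t, φ s) atTop atTop := by
      have h1 : Tendsto (fun t : ℝ ↦ C + ∫ s in (0 : ℝ)..max t 0, φ s) atTop atTop :=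
        tendsto_atTop_add_const_left _ C htop
      refine h1.congr' ?_
      filter_upwards [eventually_ge_atTop (0 : ℝ)] with t ht
      rw [max_eq_left ht]
    have hinv : Tendsto (fun t : ℝ ↦ (C + ∫ s in (0 : ℝ)..t, φ s)⁻¹) atTop (𝓝 0) :=
      tendsto_inv_atTop_zero.comp htop'
    rw [Metric.tendsto_nhds] at hinv ⊢
    intro ε hε
    have hK : 0 < √(Bφ * (Bφ + 2)) + 1 := by positivity
    filter_upwards [hinv (ε / (√(Bφ * (Bφ + 2)) + 1)) (by positivity),
      eventually_ge_atTop (0 : ℝ)] with t ht ht0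
    rw [Real.dist_eq, sub_zero] at ht ⊢
    have hdenpos : 0 < C + ∫ s in (0 : ℝ)..t, φ s := by linarith [hInn t ht0]
    rw [abs_of_nonneg (inv_nonneg.mpr hdenpos.le)] at ht
    rw [abs_of_nonneg (div_nonneg (Real.sqrt_nonneg _) hdenpos.le), div_eq_mul_inv]
    calc √(φ t * (φ t + 2)) * (C + ∫ s in (0 : ℝ)..t, φ s)⁻¹
        ≤ (√(Bφ * (Bφ + 2)) + 1) * (C + ∫ s in (0 : ℝ)..t, φ s)⁻¹ := by
          gcongr
          linarith [hnum t]
      _ < (√(Bφ * (Bφ + 2)) + 1) * (ε / (√(Bφ * (Bφ + 2)) + 1)) := by gcongr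
      _ = ε := by field_simp

/-! ### A monotone unbounded radius below a vanishing constraint -/

/-- **Growing radii under a vanishing constraint.** If `h ≥ 0` tends to `0`,
then for every `A` there are a nondecreasing `R → +∞` and a time `t₀` with
`h t · (R t + A) ≤ 1` for `t ≥ t₀` (take `R = (ĥ + e^{−t})⁻¹ − A` with `ĥ(t) = sup_{s ≥ t} h` the
antitone envelope). With `h = tilt/lag` this places the side walls `{rᵢ = Rᵢ(t*)}` of the
certified tubes where lab time dominates hole time. [folklore] -/
theorem exists_monotone_tendsto_atTop_mul_le {h : ℝ → ℝ} (h0 : ∀ t, 0 ≤ h t)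
    (hlim : Tendsto h atTop (𝓝 0)) (A : ℝ) :
    ∃ (R : ℝ → ℝ) (t₀ : ℝ), Monotone R ∧ Tendsto R atTop atTop ∧
      ∀ t, t₀ ≤ t → h t * (R t + A) ≤ 1 := by
  -- `h ≤ 1` after some time `t₀`; the envelope is taken over `[max t t₀, ∞)`
  obtain ⟨t₀, ht₀⟩ := (hlim.eventually (gt_mem_nhds one_pos)).exists_forall_of_atTop
  -- envelope `env t = sup_{s ≥ max t t₀} h s`
  have hbdd : ∀ t, BddAbove (range fun s : Ici (max t t₀) ↦ h s) := fun t ↦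
    ⟨1, by rintro _ ⟨s, rfl⟩; exact (ht₀ s ((le_max_right _ _).trans s.2)).le⟩
  have hne : ∀ t, Nonempty (Ici (max t t₀)) := fun t ↦ ⟨⟨max t t₀, self_mem_Ici⟩⟩
  set env : ℝ → ℝ := fun t ↦ ⨆ s : Ici (max t t₀), h s with henv
  have henv_ge : ∀ t, t₀ ≤ t → h t ≤ env t := fun t ht ↦ by
    exact le_ciSup (hbdd t) ⟨t, mem_Ici.mpr (by rw [max_eq_left ht])⟩
  have henv_nonneg : ∀ t, 0 ≤ env t := fun t ↦
    (h0 _).trans (le_ciSup (hbdd t) ⟨max t t₀, self_mem_Ici⟩)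
  have henv_anti : Antitone env := by
    intro t t' htt'
    haveI := hne t'
    refine ciSup_le fun s ↦ ?_
    exact le_ciSup (hbdd t) ⟨s.1, mem_Ici.mpr ((max_le_max htt' le_rfl).trans (mem_Ici.mp s.2))⟩
  have henv_lim : Tendsto env atTop (𝓝 0) := by
    rw [Metric.tendsto_nhds]
    intro ε hε
    obtain ⟨T, hT⟩ := (hlim.eventually (gt_mem_nhds (half_pos hε))).exists_forall_of_atTop
    filter_upwards [eventually_ge_atTop T, eventually_ge_atTop t₀] with t htT htt₀
    rw [Real.dist_eq, sub_zero, abs_of_nonneg (henv_nonneg t)]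
    haveI := hne t
    refine lt_of_le_of_lt (ciSup_le fun s ↦ (hT s ?_).le) (half_lt_self hε)
    exact htT.trans ((le_max_left _ _).trans (mem_Ici.mp s.2))
  -- the radius
  have hpos : ∀ t, 0 < env t + Real.exp (-t) := fun t ↦
    add_pos_of_nonneg_of_pos (henv_nonneg t) (Real.exp_pos _)
  refine ⟨fun t ↦ (env t + Real.exp (-t))⁻¹ - A, t₀, ?_, ?_, ?_⟩
  · intro t t' htt'
    have h2 : env t' + Real.exp (-t') ≤ env t + Real.exp (-t) :=
      add_le_add (henv_anti htt') (Real.exp_le_exp.mpr (neg_le_neg htt'))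
    simp only [sub_le_sub_iff_right]
    exact inv_anti₀ (hpos t') h2
  · have h1 : Tendsto (fun t ↦ env t + Real.exp (-t)) atTop (𝓝 0) := by
      simpa using henv_lim.add (Real.tendsto_exp_neg_atTop_nhds_zero)
    have h2 : Tendsto (fun t ↦ env t + Real.exp (-t)) atTop (𝓝[>] 0) :=
      tendsto_nhdsWithin_iff.mpr ⟨h1, Eventually.of_forall fun t ↦ mem_Ioi.mpr (hpos t)⟩
    have h3 : Tendsto (fun t ↦ (env t + Real.exp (-t))⁻¹) atTop atTop :=
      h2.inv_tendsto_nhdsGT_zero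
    simpa only [sub_eq_add_neg] using tendsto_atTop_add_const_right atTop (-A) h3
  · intro t ht
    rw [sub_add_cancel, ← div_eq_mul_inv, div_le_one (hpos t)]
    linarith [henv_ge t ht, Real.exp_pos (-t)]


/-- Registered sub-goal form (stub `tendsto_sqrt_div_integral` of the crux item) of
`tendsto_sqrt_div_integral'`: the tilt-to-lag ratio tends to zero. [folklore] -/
theorem tendsto_sqrt_div_integral : open MeasureTheory Filter Topology in ∀ {φ : ℝ → ℝ}, Continuous φ → (∀ t, 0 ≤ φ t) → ∀ {Bφ : ℝ}, (∀ t, φ t ≤ Bφ) → UniformContinuous φ → ∀ {C : ℝ}, 0 < C → Tendsto (fun t ↦ √(φ t * (φ t + 2)) / (C + ∫ s in (0 : ℝ)..t, φ s)) atTop (𝓝 0) :=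
  fun hc h0 _ hφB huc _ hC ↦ tendsto_sqrt_div_integral' hc h0 hφB huc hC

end Summit.FinalStateConjecture.FinalStateConjecture.Theorems.SublinearIsFree.Rechart

end
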